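import Literature.AnabelianGeometry.EtaleTheta.Discharge.Sec5TowerOfConnectedTemperoid
import HarnessLib

/-!
# [EtTh] §5: the divisor-invariance input `hinvp` of the §5 data WITHOUT any stability hypothesis on `Div(s'')` — from the
# kernel `H_⊙` alone (Prop. 4.3 (i) proof, p.317 / PDF p.91, read as printed; proof-only)

S. Mochizuki, *The étale theta function …*, Publ. RIMS **45** (2009) [MochizukiEtTh2009], Prop. 4.3 (i) proof p.317 (PDF p.91): «it suffices
to prove that `Div(s'_N)`, `Div(s''_N) ∈ Φ(A_N)` are fixed by `H_{A_N}`.  But since `N · Div(s'_N)`, `N · Div(s''_N)` arise as pull-backs to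
`A_N` of elements of `Φ(A_⊙)`, this follows from the fact that [by definition] `H` acts trivially on `A_⊙^bs` [together with the fact the
monoid `Φ(A_N)` is torsion-free!]»; §5 p.330 (PDF p.104): «the zero divisor `Div(s^⊓_N)` … descends … to `Φ(A_⊚)`» (the ZERO divisor
only) [cite: MochizukiEtTh2009, Prop 4.3 (i) p.317 (PDF p.91)].

abc-iut cell, layer L2 [EtTh]; seat abc-iut-L2-t3 (gen 7), VNEXT-CENSUS-L2 §G5 add. 7 (S2) «hθ′ READING» made kernel-precise.
PROOF-ONLY companion of abc-iut-L2-t4's `Discharge/Sec5RootDivisorInvariance.lean` and `Sec5(Tower)OfConnectedTemperoid.lean`; nothing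
landed is edited.  Those files derive the §5 input `hinvp` (`Φ(ρ_{A_N}(y))` fixes `Div(s^⊔_N)` for `y ∈ Π^tp_Ÿ`) from the hypothesis
`hθ′ : ∀ x : Π^tp_X, Φ(ρ_{A_⊙}(x))(Div s'') = Div s''` — the stability of the POLAR divisor of `Θ̈` under ALL of `Π^tp_X`.  That
hypothesis is STRONGER than print (p.317 uses only that `H = H_⊙ := Ker(Π^tp_X ↠ Aut(A_⊙^bs))` acts trivially on `A_⊙^bs`; p.104 asserts
descent for the ZERO divisor only) and FALSE at faithful data: the polar divisor `D_1` of `Θ̈` is MOVED by the translations of the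
chain (`a·D_1 = D_1 + div(ϖ̈^{a²} Ü^{−2a})`, this seat's `TateTowerTheta.actDIV_thetaPoles_ne`, Prop. 1.4 (ii) / Rmk. 1.3.1).  THIS FILE
proves `hinvp` along the printed route, with NO hypothesis on `Div(s'')`:
* `BiKummerSetting.NthRoot.pull_galoisSurj_eq_of_pow_eq_of_mem` — Galois-stability RESTRICTED TO A NORMAL SUBGROUP `H ≤ Π^tp_X`
  propagates along roots (`e^N = (α^bs)^* d`): the outer naturality of `Π^tp_X ↠ Aut_D(−)` (Def. 4.1 (ii)) conjugates inside `H`,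
  and `Φ(A_N)` is torsion-free (`Φ` divisorial);
* `BiKummerSetting.pull_galoisSurj_of_mem_ker` — the kernel acts trivially: `Φ(ρ_A(x)) = id` for `x ∈ Ker ρ_A`;
* **`ThetaFrobenioid.hinvp_of_hH`** — for the two-step root `A_⊙ ← A_l ← A_N` of §5: `Φ(ρ_{A_N}(ιX y))(Div s^⊔_N) = Div s^⊔_N` for
  every `y ∈ Π^tp_Ÿ`, from `hH : ιX(Π^tp_Ÿ) ⊆ H_⊙` (the §5 binder, a THEOREM at `A_⊙^bs := Ÿ`), `Φ` divisorial and the naturality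
  `hS` — and NOTHING about `Div(s'')`; likewise `hinvc_of_mem_Hodot` for the zero divisor restricted to `H_⊙`;
* over the genuine connected base: **`ThetaFrobenioidTower.hinvp_family_ofConnectedTemperoid_of_hH`** (every level, `hS` and `Φ`
  divisorial THEOREMS there) and **`hinvp_family_ofConnectedTemperoidYddTower`** — at abc-iut-L2-t4's §5 choice `A_⊙^bs := Ÿ`
  (`mkOfConnectedTemperoidYddTower`) the input `hinvp` of the Thm. 5.7 knits is a THEOREM with NO divisor hypothesis at all
  (`hH := hH_mkOfConnectedTemperoidYddTower`).
HONEST FRAMING: kernel-checked implications over the typed §4/§5 interfaces; `hinvc` (stability of the ZERO divisor under all of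
`Aut(A_N^bs)`) keeps its printed input `hθ` (true in print: the cusps are permuted); nothing here bears on [IUTchIII] Cor. 3.12; no side
taken; typed ≠ proved — here proved.
-/

noncomputable section

namespace Literature.AnabelianGeometry.EtaleTheta

open CategoryTheory Opposite Literature.AlgebraicGeometry.Frobenioids Literature.AnabelianGeometry.SemiGraphs

universe u₀ v₀ u v w

variable {K : Type u₀} [Field K]

/-! ## Restricted Galois-stability propagates along roots -/

namespace BiKummerSetting.NthRoot

variable {X : SemiGraphs.TemperedArithmeticGroup.{u₀} K} {D₀ : Type u₀} [Category.{v₀} D₀]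
  {V : FrdIMonoidStub.{w}} {T₀ : RealifiedDivisorMonoids (D₀ := D₀) V} {D : Type u} [Category.{v} D]
  {VD : FrdICatStub.{u, v, w} D} {S : BiKummerSetting X T₀ D VD}
  {pullFrac : ∀ {A A' : S.C} (_ : A' ⟶ A), S.biratUnits A → S.biratUnits A'}
  {A B : S.C} {f : S.biratUnits A} {P : S.FractionPair f B} {N : ℕ+} (R : S.NthRoot f P N pullFrac)

variable (hA : S.IsGaloisObj A.base) (hΦd : Objectwise (fun M _ => IsDivisorial M) S.tf.divisorMonoid)
  (hS : ∀ ⦃A' B' : D⦄ (hA' : S.IsGaloisObj A') (hB' : S.IsGaloisObj B') (b : B' ⟶ A'),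
    ∃ c : X.Pi, ∀ g : X.Pi, (S.galoisSurj B' hB' g).hom ≫ b = b ≫ (S.galoisSurj A' hA' (c * g * c⁻¹)).hom)
  (H : Subgroup X.Pi) [H.Normal]

include hA hΦd hS in
/-- **Galois-stability UNDER A NORMAL SUBGROUP propagates along roots**: if `Φ(ρ_A(x))` fixes `d ∈ Φ(A^bs)` for all `x ∈ H`, `H ⊴ Π^tp_X`,
then `Φ(ρ_{A_N}(x))` fixes every `e ∈ Φ(A_N^bs)` with `e^N = (α^bs)^* d`, for all `x ∈ H` (outer naturality conjugates inside `H`;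
`Φ(A_N)` torsion-free).  [cite: MochizukiEtTh2009, Prop 4.3 (i) p.317 (PDF p.91)] -/
theorem pull_galoisSurj_eq_of_pow_eq_of_mem {d : S.tf.divisorMonoid.obj (op A.base)} {e : S.tf.divisorMonoid.obj (op R.AN.base)}
    (he : e ^ (N : ℕ) = pull S.tf.divisorMonoid (ModelFrobenioid.baseMap R.α) d)
    (hinv : ∀ x ∈ H, pull S.tf.divisorMonoid (S.galoisSurj A.base hA x).hom d = d) (x : X.Pi) (hx : x ∈ H) :
    pull S.tf.divisorMonoid (S.galoisSurj R.AN.base R.αData.isGalois x).hom e = e := by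
  obtain ⟨c, hc⟩ := hS hA R.αData.isGalois (ModelFrobenioid.baseMap R.α)
  apply pow_injective_of_isDivisorial (hΦd R.AN.base) N
  rw [← map_pow, he, ← pull_comp, hc x, pull_comp, hinv _ (Subgroup.Normal.conj_mem inferInstance x hx c)]

include hA hΦd hS in
/-- `Div(s'_N)` is `H`-stable if `Div(s')` is (`H ⊴ Π^tp_X`). [cite: MochizukiEtTh2009, Prop 4.3 (i) p.317 (PDF p.91)] -/
theorem pull_galoisSurj_div_num_of_mem
    (hinv : ∀ x ∈ H, pull S.tf.divisorMonoid (S.galoisSurj A.base hA x).hom (ModelFrobenioid.div P.num) = ModelFrobenioid.div P.num)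
    (x : X.Pi) (hx : x ∈ H) :
    pull S.tf.divisorMonoid (S.galoisSurj R.AN.base R.αData.isGalois x).hom (ModelFrobenioid.div R.pair.num) =
      ModelFrobenioid.div R.pair.num :=
  pull_galoisSurj_eq_of_pow_eq_of_mem R hA hΦd hS H R.div_num_pow hinv x hx

include hA hΦd hS in
/-- `Div(s''_N)` is `H`-stable if `Div(s'')` is (`H ⊴ Π^tp_X`). [cite: MochizukiEtTh2009, Prop 4.3 (i) p.317 (PDF p.91)] -/
theorem pull_galoisSurj_div_den_of_mem
    (hinv : ∀ x ∈ H, pull S.tf.divisorMonoid (S.galoisSurj A.base hA x).hom (ModelFrobenioid.div P.den) = ModelFrobenioid.div P.den)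
    (x : X.Pi) (hx : x ∈ H) :
    pull S.tf.divisorMonoid (S.galoisSurj R.AN.base R.αData.isGalois x).hom (ModelFrobenioid.div R.pair.den) =
      ModelFrobenioid.div R.pair.den :=
  pull_galoisSurj_eq_of_pow_eq_of_mem R hA hΦd hS H R.div_den_pow hinv x hx

end BiKummerSetting.NthRoot

/-! ## The kernel acts trivially -/

namespace BiKummerSetting

variable {X : SemiGraphs.TemperedArithmeticGroup.{u₀} K} {D₀ : Type u₀} [Category.{v₀} D₀]
  {V : FrdIMonoidStub.{w}} {T₀ : RealifiedDivisorMonoids (D₀ := D₀) V} {D : Type u} [Category.{v} D]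
  {VD : FrdICatStub.{u, v, w} D} (S : BiKummerSetting X T₀ D VD)

/-- **«`H` acts trivially on `A^bs`»**: for `x` in the kernel of `ρ_A : Π^tp_X ↠ Aut_D(A)`, `Φ(ρ_A(x))` is the identity of `Φ(A)`.
[cite: MochizukiEtTh2009, Def 4.1 (ii) p.313 (PDF p.87)] -/
theorem pull_galoisSurj_of_mem_ker {A' : D} (hA' : S.IsGaloisObj A') {x : X.Pi} (hx : x ∈ (S.galoisSurj A' hA').ker)
    (d : S.tf.divisorMonoid.obj (op A')) : pull S.tf.divisorMonoid (S.galoisSurj A' hA' x).hom d = d := by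
  rw [MonoidHom.mem_ker] at hx
  rw [hx]
  exact pull_id _ _ d

/-- In particular `H_⊙ = Ker ρ_{A_⊙}` fixes every element of `Φ(A_⊙^bs)` («by definition `H` acts trivially on `A_⊙^bs`», p.317).
[cite: MochizukiEtTh2009, Prop 4.3 (i) p.317 (PDF p.91)] -/
theorem pull_galoisSurj_Aodot_of_mem_Hodot {x : X.Pi} (hx : x ∈ S.Hodot) (d : S.tf.divisorMonoid.obj (op S.Aodot.base)) :
    pull S.tf.divisorMonoid (S.galoisSurj S.Aodot.base S.isGalois_Aodot x).hom d = d :=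
  S.pull_galoisSurj_of_mem_ker S.isGalois_Aodot hx d

end BiKummerSetting

/-! ## The §5 two-step application `A_⊙ ← A_l ← A_N`: `hinvp` from `hH` alone -/

namespace ThetaFrobenioid

variable {X : SemiGraphs.TemperedArithmeticGroup.{u₀} K} {D₀ : Type u₀} [Category.{v₀} D₀]
  {V : FrdIMonoidStub.{w}} {T₀ : RealifiedDivisorMonoids (D₀ := D₀) V} {D : Type u} [Category.{v} D]
  {VD : FrdICatStub.{u, v, w} D} {S : BiKummerSetting X T₀ D VD}
  {pullFrac : ∀ {A A' : S.C} (_ : A' ⟶ A), S.biratUnits A → S.biratUnits A'}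
  {lv N : ℕ+} {T : ThetaEnvData.{max v w} N} {θ : S.biratUnits S.Aodot} {Bl : S.C}
  {Pl : S.FractionPair θ Bl} {Rl : S.NthRoot θ Pl lv pullFrac}
  (R : S.NthRoot Rl.root Rl.pair N pullFrac) (ιX : T.PiX ≃ₜ* X.Pi)
  (hΦd : Objectwise (fun M _ => IsDivisorial M) S.tf.divisorMonoid)
  (hS : ∀ ⦃A' B' : D⦄ (hA' : S.IsGaloisObj A') (hB' : S.IsGaloisObj B') (b : B' ⟶ A'),
    ∃ c : X.Pi, ∀ g : X.Pi, (S.galoisSurj B' hB' g).hom ≫ b = b ≫ (S.galoisSurj A' hA' (c * g * c⁻¹)).hom)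

include hΦd hS in
/-- **`Div(s^⊔_N)` is `H_⊙`-stable — with NO hypothesis on `Div(s'')`**: `H_⊙` acts trivially on `A_⊙^bs`, and `H_⊙`-stability
propagates along the two roots `A_⊙ ← A_l ← A_N` (`H_⊙ = Ker ρ_{A_⊙}` is normal).  [cite: MochizukiEtTh2009, Prop 4.3 (i) p.317 (PDF p.91)] -/
theorem pull_galoisSurj_div_den_of_mem_Hodot (x : X.Pi) (hx : x ∈ S.Hodot) :
    pull S.tf.divisorMonoid (S.galoisSurj R.AN.base R.αData.isGalois x).hom (ModelFrobenioid.div R.pair.den) =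
      ModelFrobenioid.div R.pair.den :=
  haveI : S.Hodot.Normal := by unfold BiKummerSetting.Hodot; infer_instance
  BiKummerSetting.NthRoot.pull_galoisSurj_div_den_of_mem R Rl.αData.isGalois hΦd hS S.Hodot
    (BiKummerSetting.NthRoot.pull_galoisSurj_div_den_of_mem Rl S.isGalois_Aodot hΦd hS S.Hodot
      (fun x hx => S.pull_galoisSurj_Aodot_of_mem_Hodot hx _)) x hx

include hΦd hS in
/-- The same for the zero divisor `Div(s^⊓_N)` (restricted to `H_⊙`). [cite: MochizukiEtTh2009, Prop 4.3 (i) p.317 (PDF p.91)] -/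
theorem pull_galoisSurj_div_num_of_mem_Hodot (x : X.Pi) (hx : x ∈ S.Hodot) :
    pull S.tf.divisorMonoid (S.galoisSurj R.AN.base R.αData.isGalois x).hom (ModelFrobenioid.div R.pair.num) =
      ModelFrobenioid.div R.pair.num :=
  haveI : S.Hodot.Normal := by unfold BiKummerSetting.Hodot; infer_instance
  BiKummerSetting.NthRoot.pull_galoisSurj_div_num_of_mem R Rl.αData.isGalois hΦd hS S.Hodot
    (BiKummerSetting.NthRoot.pull_galoisSurj_div_num_of_mem Rl S.isGalois_Aodot hΦd hS S.Hodot
      (fun x hx => S.pull_galoisSurj_Aodot_of_mem_Hodot hx _)) x hx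

include hΦd hS in
/-- **`hinvp` FROM `hH` ALONE**: `Φ(ρ_{A_N}(ιX y))(Div s^⊔_N) = Div s^⊔_N` for every `y ∈ Π^tp_Ÿ`, given the §5 binder
`hH : ιX(Π^tp_Ÿ) ⊆ H_⊙` — and NO stability hypothesis on the polar divisor `Div(s'')` of `Θ̈` (which print never needs and which
fails under translations).  [cite: MochizukiEtTh2009, Prop 4.3 (i) p.317 (PDF p.91)] -/
theorem hinvp_of_hH (hH : ∀ y : T.PiX, y ∈ T.PiYdd → ιX y ∈ S.Hodot) (y : T.PiX) (hy : y ∈ T.PiYdd) :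
    pull S.tf.divisorMonoid (S.galoisSurj R.AN.base R.αData.isGalois (ιX y)).hom (ModelFrobenioid.div R.pair.den) =
      ModelFrobenioid.div R.pair.den :=
  pull_galoisSurj_div_den_of_mem_Hodot R hΦd hS (ιX y) (hH y hy)

include hΦd hS in
/-- The zero divisor too is `ιX(Π^tp_Ÿ)`-stable from `hH` alone. [cite: MochizukiEtTh2009, Prop 4.3 (i) p.317 (PDF p.91)] -/
theorem hinvc_of_hH_of_mem (hH : ∀ y : T.PiX, y ∈ T.PiYdd → ιX y ∈ S.Hodot) (y : T.PiX) (hy : y ∈ T.PiYdd) :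
    pull S.tf.divisorMonoid (S.galoisSurj R.AN.base R.αData.isGalois (ιX y)).hom (ModelFrobenioid.div R.pair.num) =
      ModelFrobenioid.div R.pair.num :=
  pull_galoisSurj_div_num_of_mem_Hodot R hΦd hS (ιX y) (hH y hy)

end ThetaFrobenioid

/-! ## Over the genuine connected base `B^temp(Π^tp_X)⁰`: `hS` and `Φ` divisorial are theorems; at `A_⊙^bs := Ÿ` so is `hH` -/

namespace ThetaFrobenioidTower

variable {X : SemiGraphs.TemperedArithmeticGroup.{u₀} K} {D₀ : Type u₀} [Category.{v₀} D₀]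
  {V : FrdIMonoidStub.{w}} {T₀ : RealifiedDivisorMonoids (D₀ := D₀) V}
  {VD : FrdICatStub.{u₀ + 1, u₀, w} (ConnectedPart (BTemp X.Pi))}
  {tf : TemperedFrobenioid T₀ (ConnectedPart (BTemp X.Pi)) VD} {hZ : tf.monoidType = MonoidType.Z}
  {hP : ∀ A : (ConnectedPart (BTemp X.Pi))ᵒᵖ, IsPerfect (tf.Φ.carrier A)}
  {NH : Subgroup (Field.absoluteGaloisGroup K) → tf.category → ℕ+ → Prop} {A₀ : tf.category}
  {hA₀ : PreFrobenioid.IsFrobeniusTrivial tf.toElem A₀} {hA₀' : SemiGraphs.IsGaloisObj A₀.base.obj}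
  {pullFrac : ∀ {A A' : (BiKummerSetting.mkOfConnectedTemperoid X tf hZ hP NH A₀ hA₀ hA₀').C} (_ : A' ⟶ A),
    (BiKummerSetting.mkOfConnectedTemperoid X tf hZ hP NH A₀ hA₀ hA₀').biratUnits A →
      (BiKummerSetting.mkOfConnectedTemperoid X tf hZ hP NH A₀ hA₀ hA₀').biratUnits A'}
  {lv : ℕ+} {E : Set ℕ+} {𝒯 : ThetaEnvTower.{max u₀ w} E} (ιX : 𝒯.PiX ≃ₜ* X.Pi)
  {θ : (BiKummerSetting.mkOfConnectedTemperoid X tf hZ hP NH A₀ hA₀ hA₀').biratUnits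
    (BiKummerSetting.mkOfConnectedTemperoid X tf hZ hP NH A₀ hA₀ hA₀').Aodot}
  {Bl : (BiKummerSetting.mkOfConnectedTemperoid X tf hZ hP NH A₀ hA₀ hA₀').C}
  {Pl : (BiKummerSetting.mkOfConnectedTemperoid X tf hZ hP NH A₀ hA₀ hA₀').FractionPair θ Bl}
  {Rl : (BiKummerSetting.mkOfConnectedTemperoid X tf hZ hP NH A₀ hA₀ hA₀').NthRoot θ Pl lv pullFrac}
  (h : ModelFrobenioid.Hypotheses tf.divisorMonoid tf.ratFnFunctor)
  (R : ∀ N : ℕ+, (BiKummerSetting.mkOfConnectedTemperoid X tf hZ hP NH A₀ hA₀ hA₀').NthRoot Rl.root Rl.pair N pullFrac)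

include h in
/-- **`hinvp` at every level over `B^temp(Π^tp_X)⁰` from `hH` alone** (naturality and `Φ` divisorial are theorems there; NO `hθ′`).
[cite: MochizukiEtTh2009, Prop 4.3 (i) p.317 (PDF p.91)] -/
theorem hinvp_family_ofConnectedTemperoid_of_hH
    (hH : ∀ y : 𝒯.PiX, y ∈ 𝒯.PiYdd → ιX y ∈ (BiKummerSetting.mkOfConnectedTemperoid X tf hZ hP NH A₀ hA₀ hA₀').Hodot)
    (N : ℕ+) (y : 𝒯.PiX) (hy : y ∈ 𝒯.PiYdd) :
    pull tf.divisorMonoid ((BiKummerSetting.mkOfConnectedTemperoid X tf hZ hP NH A₀ hA₀ hA₀').galoisSurj (R N).AN.base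
      (R N).αData.isGalois (ιX y)).hom (ModelFrobenioid.div (R N).pair.den) = ModelFrobenioid.div (R N).pair.den :=
  ThetaFrobenioid.pull_galoisSurj_div_den_of_mem_Hodot (R N) h.isDivisorial
    (BiKummerSetting.mkOfConnectedTemperoid_galoisSurj_natural X tf hZ hP NH A₀ hA₀ hA₀') (ιX y) (hH y hy)

end ThetaFrobenioidTower

namespace ThetaFrobenioidTower

variable {X : SemiGraphs.TemperedArithmeticGroup.{u₀} K} {D₀ : Type u₀} [Category.{v₀} D₀]
  {V : FrdIMonoidStub.{w}} {T₀ : RealifiedDivisorMonoids (D₀ := D₀) V}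
  {VD : FrdICatStub.{u₀ + 1, u₀, w} (ConnectedPart (BTemp X.Pi))}
  {tf : TemperedFrobenioid T₀ (ConnectedPart (BTemp X.Pi)) VD} {hZ : tf.monoidType = MonoidType.Z}
  {hP : ∀ A : (ConnectedPart (BTemp X.Pi))ᵒᵖ, IsPerfect (tf.Φ.carrier A)}
  {NH : Subgroup (Field.absoluteGaloisGroup K) → tf.category → ℕ+ → Prop}
  {E : Set ℕ+} {𝒯 : ThetaEnvTower.{max u₀ w} E} {ιX : 𝒯.PiX ≃ₜ* X.Pi}
  {pullFrac : ∀ {A A' : (BiKummerSetting.mkOfConnectedTemperoidYddTower X tf hZ hP NH 𝒯 ιX).C} (_ : A' ⟶ A),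
    (BiKummerSetting.mkOfConnectedTemperoidYddTower X tf hZ hP NH 𝒯 ιX).biratUnits A →
      (BiKummerSetting.mkOfConnectedTemperoidYddTower X tf hZ hP NH 𝒯 ιX).biratUnits A'}
  {lv : ℕ+}
  {θ : (BiKummerSetting.mkOfConnectedTemperoidYddTower X tf hZ hP NH 𝒯 ιX).biratUnits
    (BiKummerSetting.mkOfConnectedTemperoidYddTower X tf hZ hP NH 𝒯 ιX).Aodot}
  {Bl : (BiKummerSetting.mkOfConnectedTemperoidYddTower X tf hZ hP NH 𝒯 ιX).C}
  {Pl : (BiKummerSetting.mkOfConnectedTemperoidYddTower X tf hZ hP NH 𝒯 ιX).FractionPair θ Bl}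
  {Rl : (BiKummerSetting.mkOfConnectedTemperoidYddTower X tf hZ hP NH 𝒯 ιX).NthRoot θ Pl lv pullFrac}
  (h : ModelFrobenioid.Hypotheses tf.divisorMonoid tf.ratFnFunctor)
  (R : ∀ N : ℕ+, (BiKummerSetting.mkOfConnectedTemperoidYddTower X tf hZ hP NH 𝒯 ιX).NthRoot Rl.root Rl.pair N pullFrac)

include h in
/-- **At the §5 choice `A_⊙^bs := Ÿ` over `B^temp(Π^tp_X)⁰` the input `hinvp` of the Thm. 5.7 knits is a THEOREM with NO divisor
hypothesis at all** (`hH := hH_mkOfConnectedTemperoidYddTower`).  [cite: MochizukiEtTh2009, Prop 4.3 (i) p.317 (PDF p.91); §5 p.330 (PDF p.104)] -/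
theorem hinvp_family_ofConnectedTemperoidYddTower (N : ℕ+) (y : 𝒯.PiX) (hy : y ∈ 𝒯.PiYdd) :
    pull tf.divisorMonoid ((BiKummerSetting.mkOfConnectedTemperoidYddTower X tf hZ hP NH 𝒯 ιX).galoisSurj (R N).AN.base
      (R N).αData.isGalois (ιX y)).hom (ModelFrobenioid.div (R N).pair.den) = ModelFrobenioid.div (R N).pair.den :=
  hinvp_family_ofConnectedTemperoid_of_hH ιX h R
    (BiKummerSetting.hH_mkOfConnectedTemperoidYddTower X tf hZ hP NH 𝒯 ιX) N y hy

end ThetaFrobenioidTower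

end Literature.AnabelianGeometry.EtaleTheta

end
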